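import Literature.Analysis.FluidPDE.LuoTitiPerturbationIdentity
import Literature.Analysis.FluidPDE.FractionalNSReynoldsPerturb
import Literature.Analysis.FluidPDE.FracHyperviscousEstimate
import Literature.Analysis.FluidPDE.FracLaplacianCurl
import HarnessLib

/-!
# Luo–Titi's perturbation solves the fractional Navier–Stokes–Reynolds system, with the
  hyperviscous term of the gradient corrector routed into the pressure (Luo–Titi 2020, §3.5)

Analysis/FluidPDE support file (everything proved; no named facts), third part of the
perturbation of the Iteration Lemma of T. Luo and E. S. Titi, Calc. Var. PDE 59 (2020) =
arXiv:1808.07595 (`Torus.LuoTiti2020_iterationLemma`; `LuoTitiPerturbation`,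
`LuoTitiPerturbationIdentity`). From the identity `(⋆_ψ)` of the cut-off perturbation
`w = wloc + ∇Z` (`wloc = ψ•wpc + ψ²•X`, `Z = ψ²ζ`) and the abstract step
`Torus.IsFracNSReynoldsOn.perturb_univ`, the triple
`(v + w, p - q_ψ, S_ψ + v ⊗ w + w ⊗ v + ℛ(f_ψ + ν(-Δ)^θ w))` solves (2.1) on `ℝ × 𝕋³`; since
`(-Δ)^θ ∇Z = ∇P_h` with the smooth scalar `P_h = ((-Δ)^θ(Z e₀))₀` (the spectral `(-Δ)^θ` commutes
with constant linear maps and with `∂ᵢ`, `Torus.fracLaplacian_clm_comp`,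
`Torus.partialDeriv_fracLaplacian_comm`), the part `ℛ(ν(-Δ)^θ ∇Z)` of the stress has divergence
`ν∇P_h` and is moved into the pressure. The hyperviscous anti-divergence of the final stress
therefore only sees the LOCAL part `wloc` of the perturbation, which lives on the jet supports
(`JetSupports`) — the form in which the crucial estimate (3.20),
`‖ℛ(ν(-Δ)^θ w)‖_{L^p} ≲ r^{3/2-3/p} λ^{2θ-1}`, is available in the tree (`FracHyperviscousEstimate`,
`sup × |support|^{1/p}`). Contents:

* `Torus.fracLaplacian_gradient_eq_gradient` — `(-Δ)^θ(∇Z) = ∇(((-Δ)^θ(Z e_{i₀}))_{i₀})` for smooth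
  scalar `Z`, `θ ≥ 0`;
* `Torus.IsFracNSReynoldsOn.of_div_eq_add_gradient` — moving a gradient from the stress to the
  pressure;
* `LuoTiti.Setup.Sψ_symm`, `Setup.Ph`, `Setup.newStress`, `Setup.newPressure` and
  **`Setup.isFracNSReynoldsOn_new`**: for `(v, p, R)` solving (2.1) on `ℝ × 𝕋³` with `R` the
  stress of the datum, `(v + w, newPressure, newStress)` solves (2.1) on `ℝ × 𝕋³`, where
  `newStress = S_ψ + v ⊗ w + w ⊗ v + ℛ(f_ψ + ν(-Δ)^θ wloc)`.

## References

* T. Luo, E. S. Titi, Calc. Var. PDE 59 (2020) = arXiv:1808.07595, §3.3 (`P_LH = Id - ∇Δ⁻¹div`,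
  the gradient part of `w^{(t)}`), §3.5 (the display defining `R_{q+1}`, (3.20)). [`LuoTiti2020`]
-/

noncomputable section

open MeasureTheory Set Filter Topology Function UnitAddTorus
open scoped InnerProductSpace ContDiff ENNReal

namespace Literature.Analysis.FluidPDE

/-! ## `(-Δ)^θ` of a gradient is a gradient -/

namespace Torus

open Literature.Analysis.FunctionSpaces FunctionSpaces.Torus

variable {d : Type} [Fintype d] [DecidableEq d]

/-- `∂ᵢ(Z e₀) = (∂ᵢZ) e₀` for a smooth scalar `Z` and a constant vector. [folklore] -/
theorem partialDeriv_smul_const_vec {Z : UnitAddTorus d → ℝ} (hZ : IsSmooth Z) (e : EuclideanSpace ℝ d) (i : d) :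
    Torus.partialDeriv i (fun z => Z z • e) = fun z => Torus.partialDeriv i Z z • e := by
  funext z
  rw [partialDeriv_smul (hZ.isContDiff (by simp)) (isContDiff_const e) i z, partialDeriv_const_apply, smul_zero, zero_add]

/-- **`(-Δ)^θ(∇Z) = ∇P_h`** with `P_h = (((-Δ)^θ (Z e_{i₀})))_{i₀}` for a smooth scalar `Z` and
`θ ≥ 0`: the spectral fractional Laplacian of the tree acts on vector fields, commutes with the
constant maps `v ↦ v_{i₀} eᵢ` (`fracLaplacian_clm_comp`) and with `∂ᵢ`
(`partialDeriv_fracLaplacian_comm`), and is additive. [cite: LuoTiti2020, §3.3 (`P_LH = Id - ∇Δ⁻¹div`)] -/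
theorem fracLaplacian_gradient_eq_gradient {θ : ℝ} (hθ : 0 ≤ θ) {Z : UnitAddTorus d → ℝ} (hZ : IsSmooth Z) (i₀ : d) :
    fracLaplacian θ (Torus.gradient Z) = Torus.gradient
      (fun y => fracLaplacian θ (fun z => Z z • EuclideanSpace.single i₀ (1 : ℝ)) y i₀) := by
  set e₀ : EuclideanSpace ℝ d := EuclideanSpace.single i₀ (1 : ℝ) with he₀
  set U : UnitAddTorus d → EuclideanSpace ℝ d := fun z => Z z • e₀ with hU
  have hUs : IsSmooth U := hZ.smul' (isSmooth_const e₀)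
  set V := fracLaplacian θ U with hV
  have hVs : IsSmooth V := hUs.fracLaplacian hθ
  set P : UnitAddTorus d → ℝ := fun y => V y i₀ with hP
  have hPs : IsSmooth P := hVs.apply i₀
  -- the constant maps `L_i v = v_{i₀} e_i`
  set L : d → (EuclideanSpace ℝ d →L[ℝ] EuclideanSpace ℝ d) := fun i =>
    (EuclideanSpace.proj i₀ : EuclideanSpace ℝ d →L[ℝ] ℝ).smulRight (EuclideanSpace.single i (1 : ℝ)) with hL
  have hL_apply : ∀ i (v : EuclideanSpace ℝ d), L i v = v i₀ • EuclideanSpace.single i (1 : ℝ) := fun i v => rfl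
  have he₀i₀ : e₀ i₀ = 1 := by simp [he₀]
  -- `∂ᵢZ eᵢ = Lᵢ (∂ᵢ U)`
  have hterm : ∀ i, (fun y => Torus.partialDeriv i Z y • EuclideanSpace.single i (1 : ℝ)) = fun y => L i (Torus.partialDeriv i U y) := by
    intro i
    funext y
    rw [hU, partialDeriv_smul_const_vec hZ e₀ i, hL_apply, PiLp.smul_apply, smul_eq_mul, he₀i₀, mul_one]
  -- the gradient as a sum
  have hgrad : Torus.gradient Z = fun y => ∑ i ∈ Finset.univ, (fun y => Torus.partialDeriv i Z y • EuclideanSpace.single i (1 : ℝ)) y :=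
    funext fun y => gradient_eq_sum_partialDeriv (hZ.isContDiff (by simp)) y
  have hsm : ∀ i ∈ (Finset.univ : Finset d), IsSmooth (fun y => Torus.partialDeriv i Z y • EuclideanSpace.single i (1 : ℝ)) :=
    fun i _ => (hZ.partialDeriv i).smul' (isSmooth_const _)
  rw [hgrad, fracLaplacian_finset_sum_of_smooth hθ Finset.univ hsm]
  funext y
  rw [gradient_eq_sum_partialDeriv (hPs.isContDiff (by simp)) y]
  refine Finset.sum_congr rfl fun i _ => ?_
  rw [hterm i, fracLaplacian_clm_comp hθ (hUs.partialDeriv i) (L i)]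
  dsimp only
  rw [← partialDeriv_fracLaplacian_comm hθ hUs i, hL_apply, ← partialDeriv_apply_coord (hVs.isContDiff (by simp)) i y i₀]

end Torus

/-! ## Moving a gradient from the stress to the pressure -/

namespace Torus

open Literature.Analysis.FunctionSpaces FunctionSpaces.Torus

variable {d : Type*} [Fintype d] [DecidableEq d]

/-- **Stress ↦ pressure**: if `(V, P, R₁)` solves (2.1) on `ℝ × 𝕋^d` and `div R₁ = div R₂ + ∇G`
for a jointly smooth symmetric `R₂` and a jointly smooth scalar `G`, then `(V, P - G, R₂)` solves
(2.1). [folklore] -/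
theorem IsFracNSReynoldsOn.of_div_eq_add_gradient {θ ν : ℝ} {V : ℝ → UnitAddTorus d → EuclideanSpace ℝ d}
    {P G : ℝ → UnitAddTorus d → ℝ} {R₁ R₂ : ℝ → UnitAddTorus d → d → EuclideanSpace ℝ d}
    (h : IsFracNSReynoldsOn univ θ ν V P R₁) (hR₂ : Torus.IsSmoothSpaceTimeOn univ R₂)
    (hR₂sym : ∀ t y, ∀ i j : d, R₂ t y i j = R₂ t y j i) (hG : Torus.IsSmoothSpaceTimeOn univ G)
    (hdiv : ∀ t y, tensorDivergence (R₁ t) y = tensorDivergence (R₂ t) y + Torus.gradient (G t) y) :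
    IsFracNSReynoldsOn univ θ ν V (fun t y => P t y - G t y) R₂ where
  smooth_velocity := h.smooth_velocity
  smooth_pressure := h.smooth_pressure.sub hG
  smooth_stress := hR₂
  momentum t _ y := by
    have hm := h.momentum t (mem_univ t) y
    rw [hdiv t y] at hm
    have hP1 : IsContDiff 1 (P t) := (h.smooth_pressure.isSmooth_slice (mem_univ t)).isContDiff (by simp)
    have hGs : IsSmooth (G t) := hG.isSmooth_slice (mem_univ t)
    have e1 : (fun y => P t y - G t y) = fun y => P t y + (-1 : ℝ) * G t y := by funext z; ring
    have hm1 : IsContDiff 1 (fun z => (-1 : ℝ) * G t z) := by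
      have : IsSmooth (fun z => (-1 : ℝ) * G t z) := contDiff_const.mul hGs
      exact this.isContDiff (by simp)
    rw [e1, gradient_add_apply hP1 hm1, gradient_const_mul_apply (hGs.isContDiff (by simp))]
    rw [← sub_eq_zero] at hm ⊢
    rw [← hm]
    simp only [neg_one_smul]
    abel
  divFree := h.divFree
  symm t _ y i j := hR₂sym t y i j

end Torus

/-! ## The new triple -/

namespace LuoTiti

open Literature.Analysis.FunctionSpaces FunctionSpaces.Torus Mikado NashGeometric Jet JetStep

/-- Notation: the three-torus and its tangent space. -/
local notation "𝕋³" => UnitAddTorus (Fin 3)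
local notation "E³" => EuclideanSpace ℝ (Fin 3)

namespace Setup

variable {S : Setup} (h : S.Valid)

/-- **The hyperviscous pressure of the gradient corrector**: `P_h = ((-Δ)^θ (Z e₀))₀`, so that
`(-Δ)^θ(∇Z) = ∇P_h`. [cite: LuoTiti2020, §3.3] -/
def Ph (θ : ℝ) (S : Setup) (t : ℝ) (y : 𝕋³) : ℝ :=
  Torus.fracLaplacian θ (fun z => S.Z t z • EuclideanSpace.single (0 : Fin 3) (1 : ℝ)) y 0

/-- **The new Reynolds stress** `S_ψ + v ⊗ w + w ⊗ v + ℛ(f_ψ + ν(-Δ)^θ wloc)` (by columns).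
[cite: LuoTiti2020, §3.5 (the display defining `R_{q+1}`)] -/
def newStress (θ ν : ℝ) (S : Setup) (v : ℝ → 𝕋³ → E³) (t : ℝ) (y : 𝕋³) (j : Fin 3) : E³ :=
  S.Sψ t y j + Torus.tensorProd (v t) (S.w t) y j + Torus.tensorProd (S.w t) (v t) y j +
    Torus.antidivergence (fun z => S.fψ t z + ν • Torus.fracLaplacian θ (S.wloc t) z) y j

/-- **The new pressure** `p - q_ψ - ν P_h`. [folklore] -/
def newPressure (θ ν : ℝ) (S : Setup) (p : ℝ → 𝕋³ → ℝ) (t : ℝ) (y : 𝕋³) : ℝ :=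
  p t y - S.qψ t y - ν * Ph θ S t y

include h

/-- `S_ψ` is symmetric. [folklore] -/
theorem Sψ_symm (t : ℝ) (y : 𝕋³) (i j : Fin 3) : S.Sψ t y i j = S.Sψ t y j i := by
  have hD := h.hD
  by_cases ht : t ∈ tsupport S.ψ
  swap
  · rw [(eq_zero_of_not_mem (S := S) ht).2.2.2.1]; rfl
  have htI : t ∈ Icc 0 S.D.T := tsupport_subset_Icc h ht
  -- `cross + Sosc = S₁ Rc - Rc` is symmetric
  have hS1 := Datum.S₁_symm hD (Rc := Rc S.D) (fun s _ z a b => Rc_symm S.D s z a b) htI y i j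
  have hRc := Rc_symm S.D t y i j
  have hcs : S.D.cross t y i j + S.D.Sosc t y i j = S.D.cross t y j i + S.D.Sosc t y j i := by
    have e : ∀ a b, S.D.S₁ (Rc S.D) t y a b = Rc S.D t y a b + S.D.cross t y a b + S.D.Sosc t y a b := by
      intro a b; simp only [Datum.S₁, PiLp.add_apply]
    rw [e, e] at hS1
    linarith
  have hp := Datum.tensorProd_symm_entries (S.D.wpc t) (wt S.D t) y i j
  have hb := Datum.tensorProd_symm_entries (wt S.D t) (wt S.D t) y i j
  simp only [Sψ, PiLp.add_apply, PiLp.smul_apply, smul_eq_mul]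
  rw [hcs, hp.1, hb.2]

/-- `P_h` is jointly smooth on `ℝ × 𝕋³` (`θ ≥ 0`). [folklore] -/
theorem smooth_Ph {θ : ℝ} (hθ : 0 ≤ θ) : Torus.IsSmoothSpaceTimeOn univ (Ph θ S) := by
  have hU : Torus.IsSmoothSpaceTimeOn univ (fun t z => S.Z t z • EuclideanSpace.single (0 : Fin 3) (1 : ℝ)) :=
    (smooth_Z h).smul (Torus.isSmoothSpaceTimeOn_const (Torus.isSmooth_const _) _)
  exact (hU.fracLaplacian_univ hθ).apply 0

/-- **Luo–Titi's new triple solves (2.1) on `ℝ × 𝕋³`.** If `(v, p, R)` is a smooth solution of the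
fractional Navier–Stokes–Reynolds system on the whole line with exponent `θ > 0`, viscosity `ν`,
and stress `R = D.M` (the stress of the datum), then `(v + w, newPressure, newStress)` is a smooth
solution on the whole line: the cut-off jet perturbation `w`, the stress
`S_ψ + v ⊗ w + w ⊗ v + ℛ(f_ψ + ν(-Δ)^θ wloc)` and the pressure `p - q_ψ - νP_h`.
[cite: LuoTiti2020, §3.5 (the display defining `R_{q+1}`)] -/
theorem isFracNSReynoldsOn_new {θ ν : ℝ} (hθ : 0 < θ) {v : ℝ → 𝕋³ → E³} {p : ℝ → 𝕋³ → ℝ}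
    (hv : Torus.IsFracNSReynoldsOn univ θ ν v p S.D.M) :
    Torus.IsFracNSReynoldsOn univ θ ν (fun t y => v t y + S.w t y) (newPressure θ ν S p) (newStress θ ν S v) := by
  have hD := h.hD
  have hd3 : 2 ≤ Fintype.card (Fin 3) := by simp
  -- the abstract step with the hyperviscous term on the full `w`
  have h1 := hv.perturb_univ hd3 hθ (smooth_w h) (isDivFree_w h) (smooth_Sψ h) (fun t y i j => Sψ_symm h t y i j)
    (smooth_qψ h) (smooth_fψ h) (integral_fψ h) (fun t y => star_psi h t y)
  -- smoothness of the pieces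
  have hvs := hv.smooth_velocity
  have hw := smooth_w h
  have hwl := smooth_wloc h
  have hZ := smooth_Z h
  have hΛw : Torus.IsSmoothSpaceTimeOn univ (fun t => Torus.fracLaplacian θ (S.w t)) := hw.fracLaplacian_univ hθ.le
  have hΛwl : Torus.IsSmoothSpaceTimeOn univ (fun t => Torus.fracLaplacian θ (S.wloc t)) := hwl.fracLaplacian_univ hθ.le
  have hgZ : Torus.IsSmoothSpaceTimeOn univ (fun t z => Torus.gradient (S.Z t) z) := hZ.gradient uniqueDiffOn_univ
  have hΛgZ : Torus.IsSmoothSpaceTimeOn univ (fun t => Torus.fracLaplacian θ (fun z => Torus.gradient (S.Z t) z)) :=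
    hgZ.fracLaplacian_univ hθ.le
  have hg1 : Torus.IsSmoothSpaceTimeOn univ (fun t z => S.fψ t z + ν • Torus.fracLaplacian θ (S.wloc t) z) :=
    (smooth_fψ h).add (hΛwl.const_smul ν)
  have hg2 : Torus.IsSmoothSpaceTimeOn univ (fun t z => ν • Torus.fracLaplacian θ (fun z => Torus.gradient (S.Z t) z) z) :=
    hΛgZ.const_smul ν
  have hA1 : Torus.IsSmoothSpaceTimeOn univ (fun t => Torus.antidivergence (fun z => S.fψ t z + ν • Torus.fracLaplacian θ (S.wloc t) z)) :=
    hg1.antidivergence convex_univ (by simp)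
  have hnew : Torus.IsSmoothSpaceTimeOn univ (newStress θ ν S v) := by
    have e : newStress θ ν S v = fun t y j => ((S.Sψ t y j + Torus.tensorProd (v t) (S.w t) y j) + Torus.tensorProd (S.w t) (v t) y j) +
        Torus.antidivergence (fun z => S.fψ t z + ν • Torus.fracLaplacian θ (S.wloc t) z) y j := rfl
    rw [e]
    exact (((smooth_Sψ h).add (hvs.tensorProd hw)).add (hw.tensorProd hvs)).add hA1
  -- the divergence identity: `div R₁ = div newStress + ν ∇P_h`
  have hPν : Torus.IsSmoothSpaceTimeOn univ (fun t y => ν * Ph θ S t y) := by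
    have := (smooth_Ph h hθ.le).const_smul ν
    simp only [smul_eq_mul] at this
    exact this
  refine h1.of_div_eq_add_gradient hnew ?_ hPν ?_
  · -- symmetry
    intro t y i j
    have hft : Torus.IsSmooth (fun z => S.fψ t z + ν • Torus.fracLaplacian θ (S.wloc t) z) := hg1.isSmooth_slice (mem_univ t)
    simp only [newStress, PiLp.add_apply]
    rw [Sψ_symm h t y i j, Torus.antidivergence_symm hft y i j, Torus.tensorProd_apply, Torus.tensorProd_apply,
      Torus.tensorProd_apply, Torus.tensorProd_apply]
    ring
  · intro t y
    have hwt : Torus.IsSmooth (S.w t) := hw.isSmooth_slice (mem_univ t)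
    have hwlt : Torus.IsSmooth (S.wloc t) := hwl.isSmooth_slice (mem_univ t)
    have hZt : Torus.IsSmooth (S.Z t) := hZ.isSmooth_slice (mem_univ t)
    have hgZt : Torus.IsSmooth (Torus.gradient (S.Z t)) := hZt.gradient
    have hft : Torus.IsSmooth (S.fψ t) := (smooth_fψ h).isSmooth_slice (mem_univ t)
    have hg1t : Torus.IsSmooth (fun z => S.fψ t z + ν • Torus.fracLaplacian θ (S.wloc t) z) := hg1.isSmooth_slice (mem_univ t)
    have hg2t : Torus.IsSmooth (fun z => ν • Torus.fracLaplacian θ (Torus.gradient (S.Z t)) z) := hg2.isSmooth_slice (mem_univ t)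
    -- `(-Δ)^θ w = (-Δ)^θ wloc + (-Δ)^θ ∇Z`
    have ew : S.w t = fun z => S.wloc t z + Torus.gradient (S.Z t) z := funext fun z => w_eq_wloc_add_gradient_Z h t z
    have eΛ : ∀ z, S.fψ t z + ν • Torus.fracLaplacian θ (S.w t) z =
        (S.fψ t z + ν • Torus.fracLaplacian θ (S.wloc t) z) + ν • Torus.fracLaplacian θ (Torus.gradient (S.Z t)) z := by
      intro z
      rw [ew, Torus.fracLaplacian_add hθ.le hwlt hgZt]
      simp only [smul_add]
      abel
    -- the old stress as `newStress + ℛ(ν (-Δ)^θ ∇Z)`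
    have eR : Torus.fracPerturbedStress θ ν v S.w S.Sψ S.fψ t = fun y j => newStress θ ν S v t y j +
        Torus.antidivergence (fun z => ν • Torus.fracLaplacian θ (Torus.gradient (S.Z t)) z) y j := by
      funext z j
      rw [Torus.fracPerturbedStress_apply, newStress]
      have e1 : (fun z => S.fψ t z + ν • Torus.fracLaplacian θ (S.w t) z) =
          fun z => (fun z => S.fψ t z + ν • Torus.fracLaplacian θ (S.wloc t) z) z + (fun z => ν • Torus.fracLaplacian θ (Torus.gradient (S.Z t)) z) z :=
        funext eΛ
      rw [e1, Torus.antidivergence_add_apply hg1t hg2t]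
      simp only [Pi.add_apply]
      abel
    have hns : Torus.IsSmooth (newStress θ ν S v t) := hnew.isSmooth_slice (mem_univ t)
    have hA2 : Torus.IsSmooth (Torus.antidivergence (fun z => ν • Torus.fracLaplacian θ (Torus.gradient (S.Z t)) z)) :=
      Torus.isSmooth_antidivergence hg2t
    rw [eR, Torus.tensorDivergence_add_apply (hns.isContDiff (by simp)) (hA2.isContDiff (by simp)),
      Torus.tensorDivergence_antidivergence hd3 hg2t]
    -- `∫ ν(-Δ)^θ∇Z = 0` and `(-Δ)^θ∇Z = ∇P_h`
    have hint : ∫ z, ν • Torus.fracLaplacian θ (Torus.gradient (S.Z t)) z = 0 := by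
      rw [integral_smul, Torus.integral_fracLaplacian_eq_zero hθ hgZt, smul_zero]
    rw [hint, sub_zero, Torus.fracLaplacian_gradient_eq_gradient hθ.le hZt 0]
    have hPt : Torus.IsSmooth (Ph θ S t) := (smooth_Ph h hθ.le).isSmooth_slice (mem_univ t)
    rw [Torus.gradient_const_mul_apply (hPt.isContDiff (by simp))]
    rfl

end Setup

end LuoTiti

end Literature.Analysis.FluidPDE
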